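import Mathlib.Analysis.SpecialFunctions.Complex.Log
import HarnessLib

/-!
# Postsingularly finite (Misiurewicz) parameters of the exponential family `E_λ(z) = λ eᶻ`

Topic `Literature/Dynamics/ExponentialFamily`. For `λ ∈ ℂ ∖ {0}` let `E_λ(z) = λ eᶻ`. The only
singular value of `E_λ` (singularity of the inverse) is the omitted value `0`; `E_λ` is called
**postsingularly finite** (a *Misiurewicz* parameter) if the orbit `0, λ, λe^λ, …` of `0` is
finite — equivalently strictly preperiodic, since `0` is omitted and hence never periodic
(Laubner–Schleicher–Vicol 2008, §2: "`E_λ` will be called postsingularly finite if its singular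
value `0` has a finite orbit, which means that the singular orbit is preperiodic";
Bergweiler 2016, §1: parameters with `E_λ^k(0) = E_λ^{k+l}(0)` (1) and
`E_λ^i(0) ≠ E_λ^j(0)` for `0 < i < j < k + l` (2)).

This is a LIGHT definition module (Mathlib's complex exponential only) for route
`MisiurewiczAndreOort` (summit Schanuel), which inlines the predicate
`λ ≠ 0 ∧ ∃ m n, m < n ∧ E_λ^[n] 0 = E_λ^[m] 0` in its items; `IsPostsingularlyFinite` is
*literally* that formula (`isPostsingularlyFinite_iff_inline` is `Iff.rfl`).

## Contents (everything proved; no named facts)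

* `postsingularOrbit λ n = E_λ^[n] 0` (Bergweiler's `f_n(λ)`: `f_1(λ) = λ`,
  `f_{n+1}(λ) = λ e^{f_n(λ)}`), with `postsingularOrbit_zero/_succ/_one/_two`, `_ne_zero`;
* `IsPostsingularlyFinite λ` and `isPostsingularlyFinite_iff` (in terms of `postsingularOrbit`);
* `HasPreperiodType λ k l` — Bergweiler's exact type: (1) and (2) with `k, l ≥ 1`;
  `HasPreperiodType.isPostsingularlyFinite`;
* `orbitModulusLE λ n R` — the first `n + 1` orbit points lie in the closed disc of radius `R`
  (bookkeeping predicate requested by the route);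
* the step equation `postsingularOrbit_succ_eq_succ_iff`: for `λ ≠ 0`,
  `a_{n+1} = a_{m+1} ↔ a_n − a_m ∈ 2πiℤ`;
* the two explicit families: `hasPreperiodType_one_one_iff` — type `(1, 1)` **iff**
  `λ ∈ 2πi(ℤ ∖ {0})` (Bergweiler 2016, §1: "If `k = l = 1`, then the set of all `λ ≠ 0`
  satisfying (1) and (2) is equal to `{2πim : m ∈ ℤ ∖ {0}}`"), and
  `hasPreperiodType_pi_mul_I_odd` — `λ = (2m + 1)πi` has type `(2, 1)`
  (`0 ↦ λ ↦ −λ ↦ −λ`); with the `IsPostsingularlyFinite` corollaries.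

## References

* B. Laubner, D. Schleicher, V. Vicol, *A combinatorial classification of postsingularly finite
  complex exponential maps*, Discrete Contin. Dyn. Syst. 22 (2008), 663–682, §2.
  [LaubnerSchleicherVicol2008]
* W. Bergweiler, *On postsingularly finite exponential maps*, Arnold Math. J. 3 (2017), 83–95
  (arXiv:1511.08440), §1, (1)–(2). [Bergweiler2016]
-/

open Complex

namespace Literature.Dynamics.ExponentialFamily

/-! ### The postsingular orbit -/

/-- The **postsingular orbit** of the exponential map `E_λ(z) = λ eᶻ`: `a_n(λ) = E_λ^[n](0)`, the
orbit of the unique singular value `0` — Bergweiler's `f_n(λ)` ("`f_1(z) = z` and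
`f_{m+1}(z) = z e^{f_m(z)}`", Bergweiler 2016, §1). [cite: Bergweiler2016, §1 (f_m)] -/
noncomputable def postsingularOrbit (l : ℂ) (n : ℕ) : ℂ :=
  (fun z : ℂ => l * Complex.exp z)^[n] 0

variable {l : ℂ} {n m : ℕ}

/-- Unfolding lemma for `postsingularOrbit`. [cite: Bergweiler2016, §1] -/
theorem postsingularOrbit_def (l : ℂ) (n : ℕ) :
    postsingularOrbit l n = (fun z : ℂ => l * Complex.exp z)^[n] 0 :=
  rfl

/-- `a_0 = 0`. [cite: Bergweiler2016, §1] -/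
@[simp] theorem postsingularOrbit_zero (l : ℂ) : postsingularOrbit l 0 = 0 := rfl

/-- The recursion `a_{n+1} = λ e^{a_n}` (`f_{m+1}(z) = z e^{f_m(z)}`). [cite: Bergweiler2016, §1] -/
theorem postsingularOrbit_succ (l : ℂ) (n : ℕ) :
    postsingularOrbit l (n + 1) = l * Complex.exp (postsingularOrbit l n) := by
  simp only [postsingularOrbit, Function.iterate_succ_apply']

/-- `a_1 = λ` (`f_1(z) = z`). [cite: Bergweiler2016, §1] -/
@[simp] theorem postsingularOrbit_one (l : ℂ) : postsingularOrbit l 1 = l := by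
  simp [postsingularOrbit_succ]

/-- `a_2 = λ e^λ`. [cite: Bergweiler2016, §1] -/
theorem postsingularOrbit_two (l : ℂ) : postsingularOrbit l 2 = l * Complex.exp l := by
  simp [postsingularOrbit_succ]

/-- For `λ ≠ 0` the orbit never returns to the omitted value `0`: `a_n ≠ 0` for `n ≠ 0` (so the
singular orbit is never periodic; LSV 2008, §1: "the singular value `0` is an omitted value, it
can never be periodic"). [cite: LaubnerSchleicherVicol2008, §1] -/
theorem postsingularOrbit_ne_zero (hl : l ≠ 0) (hn : n ≠ 0) : postsingularOrbit l n ≠ 0 := by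
  obtain ⟨k, rfl⟩ := Nat.exists_eq_succ_of_ne_zero hn
  rw [postsingularOrbit_succ]
  exact mul_ne_zero hl (Complex.exp_ne_zero _)

/-- **The step equation.** For `λ ≠ 0`, `a_{n+1} = a_{m+1}` iff `a_n − a_m ∈ 2πiℤ`
(cancel `λ` and use `e^x = e^y ↔ x − y ∈ 2πiℤ`). [folklore] -/
theorem postsingularOrbit_succ_eq_succ_iff (hl : l ≠ 0) :
    postsingularOrbit l (n + 1) = postsingularOrbit l (m + 1) ↔
      ∃ k : ℤ, postsingularOrbit l n = postsingularOrbit l m + k * (2 * Real.pi * I) := by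
  rw [postsingularOrbit_succ, postsingularOrbit_succ, mul_right_inj' hl,
    Complex.exp_eq_exp_iff_exists_int]

/-! ### Postsingularly finite parameters -/

/-- **Postsingularly finite (Misiurewicz) parameter** of the exponential family: `λ ≠ 0` and the
orbit of the singular value `0` under `E_λ(z) = λ eᶻ` is finite, i.e. `E_λ^[n](0) = E_λ^[m](0)`
for some `m < n` (then strictly preperiodic, `0` being omitted). Laubner–Schleicher–Vicol 2008,
§2: "`E_λ` will be called postsingularly finite if its singular value `0` has a finite orbit,
which means that the singular orbit is preperiodic"; Bergweiler 2016, §1, (1). Written with the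
iterate spelled out — literally the formula inlined by route `MisiurewiczAndreOort`
(`isPostsingularlyFinite_iff_inline`). [cite: LaubnerSchleicherVicol2008, §2 (definition)] -/
def IsPostsingularlyFinite (l : ℂ) : Prop :=
  l ≠ 0 ∧ ∃ m n : ℕ, m < n ∧
    (fun z : ℂ => l * Complex.exp z)^[n] 0 = (fun z : ℂ => l * Complex.exp z)^[m] 0

/-- `IsPostsingularlyFinite` is *syntactically* the route's inlined predicate. [folklore] -/
theorem isPostsingularlyFinite_iff_inline (l : ℂ) :
    IsPostsingularlyFinite l ↔
      l ≠ 0 ∧ ∃ m n : ℕ, m < n ∧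
        (fun z : ℂ => l * Complex.exp z)^[n] 0 = (fun z : ℂ => l * Complex.exp z)^[m] 0 :=
  Iff.rfl

/-- `IsPostsingularlyFinite` in terms of `postsingularOrbit`: `λ ≠ 0 ∧ ∃ m < n, a_n = a_m`.
[cite: LaubnerSchleicherVicol2008, §2] -/
theorem isPostsingularlyFinite_iff (l : ℂ) :
    IsPostsingularlyFinite l ↔
      l ≠ 0 ∧ ∃ m n : ℕ, m < n ∧ postsingularOrbit l n = postsingularOrbit l m :=
  Iff.rfl

/-- A postsingularly finite parameter is non-zero. [cite: LaubnerSchleicherVicol2008, §2] -/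
theorem IsPostsingularlyFinite.ne_zero (h : IsPostsingularlyFinite l) : l ≠ 0 := h.1

/-- **Exact preperiod type** `(k, l)` in Bergweiler's normalisation (§1, (1)–(2)): `λ ≠ 0`,
`k, l ≥ 1`, `E_λ^k(0) = E_λ^{k+l}(0)` and `E_λ^i(0) ≠ E_λ^j(0)` for `0 < i < j < k + l`
(so `k` is the preperiod and `l` the period of the singular orbit; `i = 0` may be omitted from (2)
because `a_j ≠ 0 = a_0` automatically, `postsingularOrbit_ne_zero`).
[cite: Bergweiler2016, §1, (1)–(2)] -/
def HasPreperiodType (l : ℂ) (k p : ℕ) : Prop :=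
  l ≠ 0 ∧ 0 < k ∧ 0 < p ∧ postsingularOrbit l k = postsingularOrbit l (k + p) ∧
    ∀ i j : ℕ, 0 < i → i < j → j < k + p → postsingularOrbit l i ≠ postsingularOrbit l j

/-- A parameter of some exact type is postsingularly finite. [cite: Bergweiler2016, §1] -/
theorem HasPreperiodType.isPostsingularlyFinite {k p : ℕ} (h : HasPreperiodType l k p) :
    IsPostsingularlyFinite l :=
  ⟨h.1, k, k + p, Nat.lt_add_of_pos_right h.2.2.1, h.2.2.2.1.symm⟩

/-- **Orbit modulus bound** (route bookkeeping): the first `n + 1` points `a_0, …, a_n` of the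
postsingular orbit lie in the closed disc of radius `R`. [folklore] -/
def orbitModulusLE (l : ℂ) (n : ℕ) (R : ℝ) : Prop :=
  ∀ j ≤ n, ‖postsingularOrbit l j‖ ≤ R

/-- Unfolding lemma for `orbitModulusLE`. [folklore] -/
theorem orbitModulusLE_iff (l : ℂ) (n : ℕ) (R : ℝ) :
    orbitModulusLE l n R ↔ ∀ j ≤ n, ‖postsingularOrbit l j‖ ≤ R :=
  Iff.rfl

/-- `orbitModulusLE` is monotone in the radius and antitone in the length. [folklore] -/
theorem orbitModulusLE.mono {n n' : ℕ} {R R' : ℝ} (h : orbitModulusLE l n R) (hn : n' ≤ n)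
    (hR : R ≤ R') : orbitModulusLE l n' R' :=
  fun j hj ↦ (h j (hj.trans hn)).trans hR

/-- The modulus bound at length `0` only constrains `a_0 = 0`. [folklore] -/
theorem orbitModulusLE_zero_iff (l : ℂ) (R : ℝ) : orbitModulusLE l 0 R ↔ 0 ≤ R := by
  simp [orbitModulusLE]

/-! ### The explicit families `2πi(ℤ ∖ {0})` and `(2ℤ + 1)πi` -/

/-- `exp (2πi m) = 1` in the normalisation used here. [folklore] -/
theorem exp_two_pi_mul_I_mul_int (m : ℤ) : Complex.exp (2 * Real.pi * I * m) = 1 := by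
  rw [show (2 * Real.pi * I * m : ℂ) = m * (2 * Real.pi * I) by ring]
  exact Complex.exp_int_mul_two_pi_mul_I m

/-- **Type `(1, 1)` parameters are exactly `2πi(ℤ ∖ {0})`** (Bergweiler 2016, §1: "If `k = l = 1`,
then the set of all `λ ≠ 0` satisfying (1) and (2) is equal to `{2πim : m ∈ ℤ ∖ {0}}`"):
`a_1 = a_2` means `λ = λe^λ`, i.e. `e^λ = 1`, and condition (2) is vacuous for `k + l = 2`.
[cite: Bergweiler2016, §1 (the case k = l = 1)] -/
theorem hasPreperiodType_one_one_iff (l : ℂ) :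
    HasPreperiodType l 1 1 ↔ ∃ m : ℤ, m ≠ 0 ∧ l = 2 * Real.pi * I * m := by
  constructor
  · rintro ⟨hl, -, -, heq, -⟩
    rw [postsingularOrbit_one, postsingularOrbit_two] at heq
    have hexp : Complex.exp l = 1 := by
      have : l * Complex.exp l = l * 1 := by rw [mul_one]; exact heq.symm
      exact mul_left_cancel₀ hl this
    obtain ⟨m, hm⟩ := Complex.exp_eq_one_iff.mp hexp
    refine ⟨m, ?_, by rw [hm]; ring⟩
    rintro rfl
    exact hl (by rw [hm]; simp)
  · rintro ⟨m, hm, rfl⟩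
    refine ⟨?_, one_pos, one_pos, ?_, ?_⟩
    · simp [Real.pi_ne_zero, I_ne_zero, hm]
    · rw [postsingularOrbit_one, postsingularOrbit_two, exp_two_pi_mul_I_mul_int, mul_one]
    · intro i j hi hij hj
      omega

/-- In particular `2πim`, `m ∈ ℤ ∖ {0}`, is postsingularly finite (`0 ↦ 2πim ↦ 2πim`).
[cite: Bergweiler2016, §1 (the case k = l = 1)] -/
theorem isPostsingularlyFinite_two_pi_mul_I_mul_int (m : ℤ) (hm : m ≠ 0) :
    IsPostsingularlyFinite (2 * Real.pi * I * m) :=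
  ((hasPreperiodType_one_one_iff _).mpr ⟨m, hm, rfl⟩).isPostsingularlyFinite

/-- `exp ((2m + 1)πi) = −1`. [folklore] -/
theorem exp_pi_mul_I_mul_odd (m : ℤ) : Complex.exp (Real.pi * I * (2 * m + 1)) = -1 := by
  rw [show (Real.pi * I * (2 * m + 1) : ℂ) = m * (2 * Real.pi * I) + Real.pi * I by ring,
    Complex.exp_add, Complex.exp_int_mul_two_pi_mul_I, Complex.exp_pi_mul_I, one_mul]

/-- **`λ = (2m + 1)πi` has exact type `(2, 1)`**: the orbit is `0 ↦ λ ↦ λe^λ = −λ ↦ λe^{−λ} = −λ`,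
so `a_2 = a_3`, while `a_1 = λ ≠ −λ = a_2`.
[cite: Bergweiler2016, §1, (1)–(2) with (k, l) = (2, 1)] -/
theorem hasPreperiodType_pi_mul_I_odd (m : ℤ) :
    HasPreperiodType (Real.pi * I * (2 * m + 1)) 2 1 := by
  have hodd : (2 * (m : ℂ) + 1) ≠ 0 := by
    have h : ((2 * m + 1 : ℤ) : ℂ) ≠ 0 := Int.cast_ne_zero.mpr (by omega)
    simpa using h
  have hl : (Real.pi * I * (2 * m + 1) : ℂ) ≠ 0 :=
    mul_ne_zero (mul_ne_zero (by exact_mod_cast Real.pi_ne_zero) I_ne_zero) hodd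
  have h2 : postsingularOrbit (Real.pi * I * (2 * m + 1)) 2 = -(Real.pi * I * (2 * m + 1)) := by
    rw [postsingularOrbit_two, exp_pi_mul_I_mul_odd, mul_neg_one]
  have h3 : postsingularOrbit (Real.pi * I * (2 * m + 1)) 3 = -(Real.pi * I * (2 * m + 1)) := by
    rw [postsingularOrbit_succ, h2, Complex.exp_neg, exp_pi_mul_I_mul_odd]
    simp
  refine ⟨hl, two_pos, one_pos, by rw [h2, h3], ?_⟩
  intro i j hi hij hj
  obtain ⟨rfl, rfl⟩ : i = 1 ∧ j = 2 := by omega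
  rw [postsingularOrbit_one, h2]
  intro h
  exact hl (by linear_combination h / 2)

/-- In particular `(2m + 1)πi` is postsingularly finite (`0 ↦ λ ↦ −λ ↦ −λ`).
[cite: Bergweiler2016, §1] -/
theorem isPostsingularlyFinite_pi_mul_I_mul_odd (m : ℤ) :
    IsPostsingularlyFinite (Real.pi * I * (2 * m + 1)) :=
  (hasPreperiodType_pi_mul_I_odd m).isPostsingularlyFinite

/-- The special values `πi` (type `(2, 1)`, `m = 0`) and `2πi` (type `(1, 1)`, `m = 1`) are
postsingularly finite. [cite: Bergweiler2016, §1] -/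
theorem isPostsingularlyFinite_pi_mul_I : IsPostsingularlyFinite (Real.pi * I) := by
  simpa using isPostsingularlyFinite_pi_mul_I_mul_odd 0

end Literature.Dynamics.ExponentialFamily
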